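import Summits.QuantumFields.YangMills.Theses.BalabanUVNodes
import Summits.QuantumFields.YangMills.Theorems.BalabanUVNodesN27AtAllPinsOfRecord13CoPHVCutBFreeCoreLedgerReading

/-!
# ★★★ K3⁸ LEAF AWCⱽ (dag-n27-c g16, trigger (t2⁗)): THE ITEM `Theses.BalabanUVNodes.SpineGivenEndpointR13SepCoPHV` AT EVERY VERSION SLOT `v` FROM K3 v6's FOUR READING PINS WITH **EVERY
# REMAINING SLOT AT ITS PRODUCER, N19′ AT dag-n19-w3's CORE LEDGER READING** (node N11's idle block OUT — N11 NOT READ by the item at this reading) — leaf AWUⱽ (p633814) with NODE O's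
# N16-pinned link reading `hlink`∕`hlink'` (≈115-line binders) replaced by the CORE readings `hlinkCoreV` (live; `…N19RateEdgeHolderD4AtCoreLedgerReadingV` p638503's text at
# `guard ∧ LiveSel`, ≈44 lines) ∕ `hlinkCore'` (off-live; `…AtCoreLedgerReading` p638116's generic-`cr` text at the free reading `cr'`, `guard ∧ ¬ LiveSel`, ≈52 lines); live = storey APCᴮ
# `…N27AtAllPinsOfRecord13CoPHVCutBFreeCoreLedgerReading` at `Rg := guard ∧ LiveSel`; off-live = FILE 1 §2 composer at `cr'` (rates from the pins, N19′ ⟸ dag-n19-w3 g5's ★★★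
# `keyedCoreEdgeHolderD4BFree_of_linkReadingAtCoreLedgerReading_finiteVolumeRows` p638116 §2 at `cr'`, `hx'` (B)-free); `hρ` DERIVED from `Signs`, `hunif` GONE, `hW` ↦ `hWall 0 1`; NEW rows
# `hκ₀ hWall hradii hclass hβ23`; FILE 1 `bodyBFree₁₃CoPH_of_split` + `hybridNE7Under_of_forSmallCouplings_stringwise` at `Node00.datumOfRecord₁₃SepCoPHV F 2 θ h v` — SLOT-INVARIANT by DEF-1's
# `rfl` faces (p620607), the slot's (B) ∕ END binders discarded.  Sibling of AWQⱽ `…VBFreeSqueezedLedgerReading` (the squeezed reading).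
# (cell `pub-ymgap`, D-0062 Track A, seat `pub-ymgap-dag-n27-c` gen 16; `--kind proof --supports stmt-QuantumFields-27366 --as helper`; COUNT-NEUTRAL; ONE theorem, 0 `def`, 0 `sorry`;
# a route-facing leaf, nothing may import it)

THE ITEM then costs, with NO parametric slot and NO prefix-keyed row left: the pins · `h16` · `hs hκ hcr hκ₀` · `hr hinc hS h9 hWall` · `hβ23 hβ1 hmatch hend hradii hclass` · K1's window `hβw`
· live `hζm h20 h21 hlinkCoreV` · off-live `h20' h21' hx' hlinkCore'` (`hx'` (B)-FREE).

HONEST FRAMING.  COMPOSITE-node bookkeeping BY NAME; NOT a discharge: a term of the item's type under displayed hypotheses (audit `proof.conditional`), every one a HYPOTHESIS inhabited for no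
family today (K0⁷ `Record13SepCoPHInhabited` OPEN) or a decided MODEL behind a pin (dag-n14-w1's «budget only» tower; dag-n15-a's sized genuine objects); `hlinkCoreV`∕`hlinkCore'` = NODE O's
world at the runs of record (CORE link-reading ledger) — UNPRINTED content for d = 4, 0 instances; N11 NOT READ (not booked, not discharged); `hβw` = K1's β-window currency (K1⁹ OPEN); N16 at
the loose object and `hradii ∧ hclass` = THE END's content (hypotheses); the finite-volume kernel letters ∕ `hκ₀` ∕ `hWall` are Bałaban-type SHAPES NOT PRINTED as such for d = 4; NE7b ∕ NE7c
witnesses 0∕1; `β`, `r` LETTERS; `jc sh cr' 𝔯 ksel ℓ s ℓ₃ g B c'` FREE (no reading minted); nothing of Bałaban's or King's asserted or instantiated; NOT `stub_rates13HV` ∕ `stub_expansion13HV`;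
N14–N22 ∕ N27 NOT discharged; K3⁸ OPEN, NOT claimed; skeleton v6 untouched; counts UNMOVED (typed 28∕28 · discharged 5∕27, A 5∕28); one finite four-torus programme at fixed `ε` — R4 is the
CONDITIONAL finite-𝕋⁴ rung `BalabanLadder.UV` only: NOT ℝ⁴, NOT infinite volume, NOT OS, NOT a mass gap, NOT Clay.  No decl below carries a cite tag.
-/

set_option autoImplicit false

namespace Summit.QuantumFields.YangMills.Theorems.BalabanUVNodesN27SpineRecord
open scoped BigOperators Matrix Matrix.Norms.L2Operator
open Finset MeasureTheory
open Literature.MathematicalPhysics.QuantumFieldTheory.Balaban1983to89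
open T4OutputRate T4RecentScale T4GoodClassBudget T4CauchySum T4TowerRateComposition T4TowerRateDischarge
open T4EtaRateMin (Readings NE3Shape)
open T4RateLiaison (GaugeDominated)
open FlowStep (RGEqH prefixOf)
open TreeLengthTorus (TFaceConnected torusTreeLen)
open B12TreeDecay (kappa₀)
open Summit.QuantumFields.BalabanUV.T4Continuum
open AveragingDeficitDualResidual (dualC1 dualC2)
open AveragingDeficitDerivWallProof (wallConst)
open AveragingDeficitPeriodicCounting (IsPeriodicDir)
open MinimalActionSandwich (IsMinimiser minAct)
open MinimalActionRate (sfClass)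
open MinimalActionRefine (RegularSup gradConst)
open NE3EnergyShapes (IsUnitarySite IsPeriodicSite)
open NE3.LeafIndexSockets (LeafH3sup)
open Summit.QuantumFields.BalabanUV.T4Continuum.Spine
open Summit.QuantumFields.BalabanUV.T4Continuum.Spine.NE4 (runFlow)
open Summit.QuantumFields.BalabanUV.T4Continuum.NE1p.DressedRoot (DressedTower DressedStabilityStrict)
open Summit.QuantumFields.YangMills.BalabanUVNodes.N19LedgerLinkSync (LedgerDataSync LedgerAtSync)
open YMDAG.UVSplit
open Summit.QuantumFields.YangMills.BalabanUVNodes.N16HolderDefs (CovRootHolder N16HolderAt)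
open Summit.QuantumFields.YangMills.BalabanUVNodes.SpineRatesHolder (RatesHolderAt)
open Literature.MathematicalPhysics.QuantumFieldTheory.Balaban1983to89.T4Continuum (T4Family ULoop)
open Node00 (Stage13HParams datumOfRecord₁₃CoPH SiteSeqKey U3Letters₁₁ NE3Letters₁₁ ne3ConstLayerOfRecord₁₁ ne3NperOfRecord₁₁ ne3DomOfRecord₁₁ ZetaMeasurable ppSelLiveOfRecord
  EOfRecord₁₃ wOfRecord₉ localBgMeasurable)
open Literature.MathematicalPhysics.QuantumFieldTheory.Balaban1983to89.B12Sec2to5 (betaPrime510)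
open Literature.MathematicalPhysics.QuantumFieldTheory.Balaban1983to89.Node00.U3OfKernels (objectsOfRecord₁₃ KernelDecayOfRecord₁₃)
open Literature.MathematicalPhysics.QuantumFieldTheory.Balaban1983to89.Node00.U3KernelLetters (GeometricIncrementsOfRecord₁₃ WindowedNE9OfRecord₁₃ WindowedDecayOfRecord₁₃
  WindowedStepRateOfRecord₁₃)
open Summit.QuantumFields.YangMills.BalabanUVNodes.N16PinnedLayer13CoPH (N16PinnedLoose N16LettersEnd rateCarriers_ne3_of_pinnedLoose)
open Summit.QuantumFields.YangMills.BalabanUVNodes.N19TargetClassWeightsE1Keyed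
open YMDAG.N14.TopBorn (Ne1PinnedOfRecord n14At_rateCarriersOfRecord₁₃CoPH_of_pinned)
open Summit.QuantumFields.YangMills.BalabanUVNodes.N15.GenuineRecord (fullGSizedObjects n15At_fullGSizedObjects_family)
open Summit.QuantumFields.YangMills.BalabanUVNodes.N15.AtKeyedHome (neZero_blockFactor)
open YMDAG.N18.PolLimitRate (u3KernelInputs_of_finiteVolumeLetters)
open T4WeightBudget T4IndicatorShell T4ContinuumYM4Torus T4ApexHybrid
open Summit.QuantumFields.YangMills.Theses.BalabanUVNodes (SpineGivenEndpointR13SepCoPHV)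
open Summit.QuantumFields.YangMills.BalabanUVNodes.N19RateEdgeHolderD4AtCoreLedgerReading (keyedCoreEdgeHolderD4BFree_of_linkReadingAtCoreLedgerReading_finiteVolumeRows)
variable (K₀ : ℕ) (jc : (F : T4Family) → (θ : Stage13HParams F 2) → θ.Provisos₁₃CoPH F 2 → (ℕ → ℝ) → List (ULoop F) → ℕ → ℕ)
  (sh : ShellSplit₁₃CoPH 2 K₀) (cr' : (F : T4Family) → (θ : Stage13HParams F 2) → θ.Provisos₁₃CoPH F 2 → (ℕ → ℝ) → List (ULoop F) → SpineCarriers)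
  (β : ℝ) (𝔯 : RateReading₁₃CoPH 2)
  (ℓ : (F : T4Family) → Stage13HParams F 2 → U3Letters₁₁) (s : (F : T4Family) → Stage13HParams F 2 → ℕ) (r : (F : T4Family) → Stage13HParams F 2 → ℝ)
  (ℓ₃ : T4Family → NE3Letters₁₁) (g B c' : T4Family → ℝ)

/-- ★★★ **THE ITEM `SpineGivenEndpointR13SepCoPHV` AT EVERY VERSION SLOT — ALL PINS, EVERY REMAINING SLOT AT ITS PRODUCER, N19′ AT THE CORE LEDGER READING, NO PREFIX-KEYED ROW** (`N = 2`,
guard `ZhUnity ∧ SlotsNondegenerate₁₃`, `hP := h.toCore`; live = APCᴮ §1 at `Rg := guard ∧ LiveSel` with `hsel := hRg.2`; off-live = FILE 1 §2 `bodyBFree₁₃CoPH_of_keyedFacesP_bFree` at `cr'` with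
the rates built from the pins, the N19′ face ⟸ dag-n19-w3 g5's (B)-free supplier `keyedCoreEdgeHolderD4BFree_of_linkReadingAtCoreLedgerReading_finiteVolumeRows` at `cr'` from `hlinkCore'`, and
`hx'`; FILE 1 `bodyBFree₁₃CoPH_of_split` + `hybridNE7Under_of_forSmallCouplings_stringwise` at `Node00.datumOfRecord₁₃SepCoPHV F 2 θ h v`, the slot's (B) ∕ endpoint binders discarded).  NOT a
discharge; every row a HYPOTHESIS or a decided MODEL; N11 NOT READ; no node discharged; K3⁸ OPEN. [bookkeeping] -/
theorem spineGivenEndpointR13SepCoPHV_of_liveV5PinsAtCrOfRecord₁₃VAt_cut_coreLedgerReadingV_offLive_v5pins_coreLedgerReading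
    (ksel : (F : T4Family) → (θ : Stage13HParams F 2) → θ.Provisos₁₃CoPH F 2 → (ℕ → ℝ) → List (ULoop F) → ℕ)
    (hpin1 : Ne1PinnedOfRecord 𝔯)
    (hpin2 : ∃ (b aS : ℝ) (ν μ α β' : Fin 4) (c35 p : ℝ), 0 < b ∧ 0 < aS ∧
      ∀ (F : T4Family) (θ : Stage13HParams F 2) (hP : θ.Provisos₁₃CoPH F 2) (g₀ : ℕ → ℝ) (os : List (ULoop F)) (k : ℕ),
        (𝔯.lit F θ hP g₀ os).ne2 k = haveI := neZero_blockFactor F; fullGSizedObjects 3 F.hL b aS ν μ α β' c35 p)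
    (hpinL : N16PinnedLoose 𝔯 ℓ₃ B)
    (hpin : ∀ (F : T4Family) (θ : Stage13HParams F 2) (hP : θ.Provisos₁₃CoPH F 2) (g₀ : ℕ → ℝ) (os : List (ULoop F)),
      (𝔯.lit F θ hP g₀ os).u3 = objectsOfRecord₁₃ F 2 θ.toStage13Params (ℓ F θ))
    (h16 : ∀ (F : T4Family), (∃ θ : Stage13HParams F 2, θ.Provisos₁₃CoPH F 2 ∧ (θ.ZhUnity F 2 ∧ θ.SlotsNondegenerate₁₃ F 2) ∧ θ.Admissible F 2) →
      N16HolderAt (ne3OfRecord₁₁ F { ne3ConstLayerOfRecord₁₁ F 2 (ℓ₃ F) with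
        dom := {V | V ∈ ne3DomOfRecord₁₁ F 2 0 0 ∧ V ∈ sfClass 4 F.L (ne3NperOfRecord₁₁ F 0 0) ((ℓ₃ F).ε / B F) 0} }) β)
    (hs : ∀ (F : T4Family) (θ : Stage13HParams F 2), θ.Provisos₁₃CoPH F 2 → (θ.ZhUnity F 2 ∧ θ.SlotsNondegenerate₁₃ F 2) → θ.Admissible F 2 → (ℓ F θ).Signs)
    (hκ : ∀ (F : T4Family) (θ : Stage13HParams F 2), θ.Provisos₁₃CoPH F 2 → (θ.ZhUnity F 2 ∧ θ.SlotsNondegenerate₁₃ F 2) → θ.Admissible F 2 → 0 < (ℓ F θ).κ)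
    (hcr : ∀ (F : T4Family) (θ : Stage13HParams F 2), θ.Provisos₁₃CoPH F 2 → (θ.ZhUnity F 2 ∧ θ.SlotsNondegenerate₁₃ F 2) → θ.Admissible F 2 →
      betaPrime510 4 1 (ℓ F θ).κ ≤ (ℓ F θ).cr)
    (hκ₀ : ∀ (F : T4Family) (θ : Stage13HParams F 2), θ.Provisos₁₃CoPH F 2 → (θ.ZhUnity F 2 ∧ θ.SlotsNondegenerate₁₃ F 2) → θ.Admissible F 2 → kappa₀ (4 * 2 ^ 4) (2 * 4) ≤ (ℓ F θ).κ)
    (hr : ∀ (F : T4Family) (θ : Stage13HParams F 2), θ.Provisos₁₃CoPH F 2 → (θ.ZhUnity F 2 ∧ θ.SlotsNondegenerate₁₃ F 2) → θ.Admissible F 2 → r F θ < 1)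
    (hinc : ∀ (F : T4Family) (θ : Stage13HParams F 2), θ.Provisos₁₃CoPH F 2 → (θ.ZhUnity F 2 ∧ θ.SlotsNondegenerate₁₃ F 2) → θ.Admissible F 2 →
      GeometricIncrementsOfRecord₁₃ F 2 θ.toStage13Params (r F θ))
    (hS : ∀ (F : T4Family) (θ : Stage13HParams F 2), θ.Provisos₁₃CoPH F 2 → (θ.ZhUnity F 2 ∧ θ.SlotsNondegenerate₁₃ F 2) → θ.Admissible F 2 →
      WindowedStepRateOfRecord₁₃ F 2 θ.toStage13Params (s F θ) (ℓ F θ).κ (ℓ F θ).θ₅ ((ℓ F θ).C₅ * (ℓ F θ).θ₅))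
    (h9 : ∀ (F : T4Family) (θ : Stage13HParams F 2), θ.Provisos₁₃CoPH F 2 → (θ.ZhUnity F 2 ∧ θ.SlotsNondegenerate₁₃ F 2) → θ.Admissible F 2 →
      WindowedNE9OfRecord₁₃ F 2 θ.toStage13Params (ℓ F θ).κ (ℓ F θ).moduli)
    (hWall : ∀ (μ ν : Fin 4) (F : T4Family) (θ : Stage13HParams F 2), θ.Provisos₁₃CoPH F 2 → (θ.ZhUnity F 2 ∧ θ.SlotsNondegenerate₁₃ F 2) → θ.Admissible F 2 →
      WindowedDecayOfRecord₁₃ F 2 θ.toStage13Params μ ν (ℓ F θ).κ)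
    (hβ23 : 2 / 3 < β) (hβ1 : β ≤ 1)
    (hmatch : ∀ F : T4Family, 0 < B F ∧ (ℓ₃ F).ε / B F ≤ (ℓ₃ F).b)
    (hend : N16LettersEnd 2 g ℓ₃)
    (hradii : ∀ F : T4Family, (ℓ₃ F).g = gradConst 4 (c' F) ∧ 0 ≤ c' F ∧ 0 < c' F ∧ (ℓ₃ F).b ≤ c' F ∧
      (2 : ℝ) ^ 91 * (F.L : ℝ) ^ 17 * c' F ≤ 1 ∧ (2 : ℝ) ^ 76 * (F.L : ℝ) ^ 12 * c' F ≤ (ℓ₃ F).ε ∧ (ℓ₃ F).ε / B F ≤ 1 / 4 ∧ 4 * ((ℓ₃ F).ε / B F) ≤ c' F)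
    (hclass : ∀ F : T4Family, 16 * B7Prop2Explicit.C0 4 * (ℓ₃ F).ε ≤ 3 ∧ 1024 * (4 + 1) * (4 + 4) * (F.L : ℝ) ^ 2 * (ℓ₃ F).ε ≤ 1)
    (hβw : ∀ (F : T4Family) (θ : Stage13HParams F 2) (hP : θ.Provisos₁₃CoPH F 2), (θ.ZhUnity F 2 ∧ θ.SlotsNondegenerate₁₃ F 2) → θ.Admissible F 2 →
      ∃ γ₀ b b' : ℝ, 0 < γ₀ ∧ 0 < b ∧ DagBinding.BetaBoundsInInterval (datumOfRecord₁₃CoPH F 2 θ hP).C.toB12 γ₀ b b')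
    (hζm : ∀ (F : T4Family) (θ : Stage13HParams F 2), θ.Provisos₁₃CoPH F 2 → ((θ.ZhUnity F 2 ∧ θ.SlotsNondegenerate₁₃ F 2) ∧ θ.ppSel = ppSelLiveOfRecord F 2 θ.ν θ.τ9 (EOfRecord₁₃ F 2 θ.toStage13Params) (wOfRecord₉ F 2 θ.toStage9Params)) → θ.Admissible F 2 →
      ZetaMeasurable F 2 θ.ζ)
    (h20 : ∀ (F : T4Family) (θ : Stage13HParams F 2) (hP : θ.Provisos₁₃CoPH F 2), ((θ.ZhUnity F 2 ∧ θ.SlotsNondegenerate₁₃ F 2) ∧ θ.ppSel = ppSelLiveOfRecord F 2 θ.ν θ.τ9 (EOfRecord₁₃ F 2 θ.toStage13Params) (wOfRecord₉ F 2 θ.toStage9Params)) → θ.Admissible F 2 →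
      ∀ (g₀ : ℕ → ℝ) (os : List (ULoop F)),
        ∃ W : ℕ → ℝ, RelWeightBound 1 (classSet₁₃ θ K₀ g₀) (weightA₁₃ θ hP K₀ g₀ os) (weightB₁₃ θ hP K₀ g₀ os) (badClass₁₃ θ K₀ g₀ (jc F θ hP g₀ os)) W)
    (h21 : ∀ (F : T4Family) (θ : Stage13HParams F 2) (hP : θ.Provisos₁₃CoPH F 2), ((θ.ZhUnity F 2 ∧ θ.SlotsNondegenerate₁₃ F 2) ∧ θ.ppSel = ppSelLiveOfRecord F 2 θ.ν θ.τ9 (EOfRecord₁₃ F 2 θ.toStage13Params) (wOfRecord₉ F 2 θ.toStage9Params)) → θ.Admissible F 2 →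
      ∀ (g₀ : ℕ → ℝ) (os : List (ULoop F)),
        ∃ Wsh : ℕ → ℝ, ShellWeightBound 1 (classSet₁₃ θ K₀ g₀) (weightA₁₃ θ hP K₀ g₀ os) (weightB₁₃ θ hP K₀ g₀ os) (sh F θ hP g₀ os).1 (sh F θ hP g₀ os).2 Wsh)
    (hlinkCoreV : ∀ (F : T4Family) (θ : Stage13HParams F 2) (hP : θ.Provisos₁₃CoPH F 2), ((θ.ZhUnity F 2 ∧ θ.SlotsNondegenerate₁₃ F 2) ∧ θ.ppSel = ppSelLiveOfRecord F 2 θ.ν θ.τ9 (EOfRecord₁₃ F 2 θ.toStage13Params) (wOfRecord₉ F 2 θ.toStage9Params)) → θ.Admissible F 2 →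
      ∀ (γ gIR b : ℝ) (g₀ : ℕ → ℝ), (datumOfRecord₁₃CoPH F 2 θ hP).Tuned γ gIR g₀ → γ ≤ θ.γ → γ ^ 2 ≤ Real.exp (-1) → 0 < b →
      (∀ K m, 0 ≤ m → m < K → b ≤ (datumOfRecord₁₃CoPH F 2 θ hP).βfun m (prefixOf (runFlow (datumOfRecord₁₃CoPH F 2 θ hP) g₀ K) m)) →
      ∀ (os : List (ULoop F)) (k : ℕ),
      let S : SpineCarriers := crOfRecord₁₃VAt K₀ (jc F θ hP g₀ os) sh F θ hP g₀ os
      let R : RateCarriers 2 := rateCarriersOfRecord₁₃CoPH 𝔯 F θ hP g₀ os k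
      let D : Datum F 2 := datumOfRecord₁₃CoPH F 2 θ hP
      letI := S.dec
      ∃ (_ : DecidableEq R.u3.C.Dom) (F' : Type) (ι' X' : Type) (_ : MeasurableSpace ι')
        (L : LedgerDataSync R.u3.C F' ι' S.ι) (Rd : Readings ι' X') (bsel : (ℕ → ℝ) → ℝ) (EB : Functional R.u3.C R.u3.C.BgB)
        (g : ℕ → ℕ → ℝ)
        (uA : ℕ → ι' → R.u3.C.BgA) (uB : ℕ → ι' → R.u3.C.BgB)
        (Koff : ℕ) (cells : (K j : ℕ) → R.u3.C.Dom → Finset (Site (F.P (Koff + K)) j))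
        (θ : ℝ)
        (sel : ℕ → (B7Prop1Explicit.Site 4 → Fin 4 → (Matrix (Fin 2) (Fin 2) ℂ)ˣ) → (B7Prop1Explicit.Site 4 → Fin 4 → (Matrix (Fin 2) (Fin 2) ℂ)ˣ))
        (rd : ι' → (B7Prop1Explicit.Site 4 → Fin 4 → (Matrix (Fin 2) (Fin 2) ℂ)ˣ)),
        (∀ K i, i ≤ K → g K i = runFlow D g₀ K i) ∧ (∀ K i, K < i → g K i = gIR) ∧
        EB = (fun s => R.u3.EB (bsel s) s) ∧
        (∀ (Sz : ℕ → ℝ → S.ι → ℕ → ℝ) (E₀ : ℝ) (m : ℕ) (a : ℝ) (Cw Λg : ℝ),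
          (∀ K t, |t| ≤ S.l₀ → ∀ τ ∈ S.T K \ S.Bad K t, ∀ v ∈ Rd.dom, ∀ j ≤ K,
            |∑ X ∈ L.fac K t τ with R.u3.C.scale X = j,
                (Real.log (Real.exp (EB (fun i => g (K + 1) (i + 1)) (uB K v) X
                    - EB (fun i => g (K + 1) (i + 1)) L.oneB X))
                  - Real.log (Real.exp (R.u3.EA (g K) (uA K v) X - R.u3.EA (g K) L.oneA X)))| ≤ Sz K t τ j) →
          0 ≤ E₀ → 0 < a → a < 1 →
          (∀ K t, |t| ≤ S.l₀ → ∀ τ ∈ S.T K \ S.Bad K t, ∀ j ≤ K,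
            Sz K t τ j ≤ S.vol * (E₀ * ((K : ℝ) + 1) ^ m * a ^ (K - j))) →
          (∀ K, Multiplicity (L.All K) R.u3.C.scale (fun X => Real.exp (-(R.u3.κ * R.u3.C.d X))) Cw S.vol Λg K) →
          (∀ K t, |t| ≤ S.l₀ → ∀ τ ∈ S.T K \ S.Bad K t,
            WindowMultiplicity (L.facO K t τ) L.scO L.wO Cw S.vol Λg (jlogOf L.Cl K) K) →
          1 ≤ Λg → L.θ' ≤ Λg →
          LedgerAtSync { L with S := Sz, E₀ := E₀, m := m, a := a, Cw := Cw, Λg := Λg } S.l₀ S.vol S.T S.Bad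
            (fun K t τ => S.A K t τ - S.shA K t τ) (fun K t τ => S.B K t τ - S.shB K t τ) Rd R.u3.EA EB R.u3.κ g uA uB
            R.u3.ω R.u3.ρ R.u3.θ (θ ^ ((3 : ℝ) * β - 2))) ∧
        (∀ K t, |t| ≤ S.l₀ → ∀ τ ∈ S.T K \ S.Bad K t,
          WindowMultiplicity (L.facO K t τ) L.scO L.wO L.Cw S.vol L.Λg (jlogOf L.Cl K) K) ∧
        0 ≤ L.Cw ∧ 1 ≤ L.Λg ∧ L.θ' ≤ L.Λg ∧
        (∀ K, ∀ X ∈ L.All K,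
          (cells K (R.u3.C.scale X + Koff) X).Nonempty ∧ TFaceConnected (cells K (R.u3.C.scale X + Koff) X)) ∧
        (∀ K j, Set.InjOn (cells K j) ↑((L.All K).filter fun X => R.u3.C.scale X + Koff = j)) ∧
        (∀ K, ∀ X ∈ L.All K, torusTreeLen (cells K (R.u3.C.scale X + Koff) X) ≤ R.u3.C.d X) ∧
        LeafH3sup 4 R.ne3.L R.ne3.Nper R.ne3.ε R.ne3.b (c' F) R.ne3.dom ∧
        (∀ V ∈ R.ne3.dom, ∀ k : ℕ, IsMinimiser 4 (sfClass 4 R.ne3.L R.ne3.Nper R.ne3.ε) R.ne3.L R.ne3.Nper k V (sel k V)) ∧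
        (∀ V ∈ R.ne3.dom, ∀ k : ℕ, RegularSup 4 R.ne3.L R.ne3.Nper R.ne3.b (c' F) k (sel k V)) ∧
        0 < θ ∧ θ ^ 6 = ((R.ne3.L : ℝ))⁻¹ ∧
        (∀ v ∈ Rd.dom, rd v ∈ R.ne3.dom) ∧
        (∀ k, ∀ v ∈ Rd.dom, Rd.act k v = minAct 4 (sfClass 4 R.ne3.L R.ne3.Nper R.ne3.ε) R.ne3.L R.ne3.Nper k (rd v)) ∧
        (R.ne3.Nper : ℝ) ^ 4 ≤ Rd.vol ∧
        (∀ s ∈ Window γ, 0 < bsel s ∧ bsel s ≤ γ))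
    (h20' : ∀ (F : T4Family) (θ : Stage13HParams F 2) (hP : θ.Provisos₁₃CoPH F 2), ((θ.ZhUnity F 2 ∧ θ.SlotsNondegenerate₁₃ F 2) ∧ ¬ θ.ppSel = ppSelLiveOfRecord F 2 θ.ν θ.τ9 (EOfRecord₁₃ F 2 θ.toStage13Params) (wOfRecord₉ F 2 θ.toStage9Params)) → θ.Admissible F 2 →
      ∀ (g₀ : ℕ → ℝ) (os : List (ULoop F)),
        RelWeightBound (cr' F θ hP g₀ os).l₀ (cr' F θ hP g₀ os).T (cr' F θ hP g₀ os).A (cr' F θ hP g₀ os).B (cr' F θ hP g₀ os).Bad (cr' F θ hP g₀ os).W)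
    (h21' : ∀ (F : T4Family) (θ : Stage13HParams F 2) (hP : θ.Provisos₁₃CoPH F 2), ((θ.ZhUnity F 2 ∧ θ.SlotsNondegenerate₁₃ F 2) ∧ ¬ θ.ppSel = ppSelLiveOfRecord F 2 θ.ν θ.τ9 (EOfRecord₁₃ F 2 θ.toStage13Params) (wOfRecord₉ F 2 θ.toStage9Params)) → θ.Admissible F 2 →
      ∀ (g₀ : ℕ → ℝ) (os : List (ULoop F)),
        ShellWeightBound (cr' F θ hP g₀ os).l₀ (cr' F θ hP g₀ os).T (cr' F θ hP g₀ os).A (cr' F θ hP g₀ os).B (cr' F θ hP g₀ os).shA (cr' F θ hP g₀ os).shB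
          (cr' F θ hP g₀ os).Wsh)
    (hx' : ∀ (F : T4Family) (θ : Stage13HParams F 2) (hP : θ.Provisos₁₃CoPH F 2), ((θ.ZhUnity F 2 ∧ θ.SlotsNondegenerate₁₃ F 2) ∧ ¬ θ.ppSel = ppSelLiveOfRecord F 2 θ.ν θ.τ9 (EOfRecord₁₃ F 2 θ.toStage13Params) (wOfRecord₉ F 2 θ.toStage9Params)) → θ.Admissible F 2 →
        ForSmallCouplings (datumOfRecord₁₃CoPH F 2 θ hP) fun g₀ => ∀ os : List (ULoop F),
          0 < (cr' F θ hP g₀ os).l₀ ∧ 0 < (cr' F θ hP g₀ os).vol ∧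
          (∀ (K : ℕ) (t : ℝ), |t| ≤ (cr' F θ hP g₀ os).l₀ →
            T4GenFunBounds.schemeZ ((datumOfRecord₁₃CoPH F 2 θ hP).scheme g₀) os ((cr' F θ hP g₀ os).K₀ + K) t =
              ∑ τ ∈ (cr' F θ hP g₀ os).T K, (cr' F θ hP g₀ os).A K t τ) ∧
          (∀ (K : ℕ) (t : ℝ), |t| ≤ (cr' F θ hP g₀ os).l₀ →
            T4GenFunBounds.schemeZ ((datumOfRecord₁₃CoPH F 2 θ hP).scheme g₀) os ((cr' F θ hP g₀ os).K₀ + K + 1) t =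
              ∑ τ ∈ (cr' F θ hP g₀ os).T K, (cr' F θ hP g₀ os).B K t τ))
    (hlinkCore' : ∀ (F : T4Family) (θ : Stage13HParams F 2) (hP : θ.Provisos₁₃CoPH F 2), ((θ.ZhUnity F 2 ∧ θ.SlotsNondegenerate₁₃ F 2) ∧ ¬ θ.ppSel = ppSelLiveOfRecord F 2 θ.ν θ.τ9 (EOfRecord₁₃ F 2 θ.toStage13Params) (wOfRecord₉ F 2 θ.toStage9Params)) → θ.Admissible F 2 →
      ∀ (γ gIR b : ℝ) (g₀ : ℕ → ℝ), (datumOfRecord₁₃CoPH F 2 θ hP).Tuned γ gIR g₀ → γ ≤ θ.γ → γ ^ 2 ≤ Real.exp (-1) → 0 < b →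
      (∀ K m, 0 ≤ m → m < K → b ≤ (datumOfRecord₁₃CoPH F 2 θ hP).βfun m (prefixOf (runFlow (datumOfRecord₁₃CoPH F 2 θ hP) g₀ K) m)) →
      ∀ (os : List (ULoop F)) (k : ℕ),
      let S : SpineCarriers := cr' F θ hP g₀ os
      let R : RateCarriers 2 := rateCarriersOfRecord₁₃CoPH 𝔯 F θ hP g₀ os k
      let D : Datum F 2 := datumOfRecord₁₃CoPH F 2 θ hP
      letI := S.dec
      ∃ (_ : DecidableEq R.u3.C.Dom) (F' : Type) (ι' X' : Type) (_ : MeasurableSpace ι')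
        (L : LedgerDataSync R.u3.C F' ι' S.ι) (Rd : Readings ι' X') (bsel : (ℕ → ℝ) → ℝ) (EB : Functional R.u3.C R.u3.C.BgB)
        (g : ℕ → ℕ → ℝ)
        (uA : ℕ → ι' → R.u3.C.BgA) (uB : ℕ → ι' → R.u3.C.BgB)
        (Pf : ℕ → Params) (d₀ L₀ Koff : ℕ) (cells : (K j : ℕ) → R.u3.C.Dom → Finset (Site (Pf K) j))
        (θ : ℝ)
        (sel : ℕ → (B7Prop1Explicit.Site 4 → Fin 4 → (Matrix (Fin 2) (Fin 2) ℂ)ˣ) → (B7Prop1Explicit.Site 4 → Fin 4 → (Matrix (Fin 2) (Fin 2) ℂ)ˣ))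
        (rd : ι' → (B7Prop1Explicit.Site 4 → Fin 4 → (Matrix (Fin 2) (Fin 2) ℂ)ˣ)),
        (∀ K i, i ≤ K → g K i = runFlow D g₀ K i) ∧ (∀ K i, K < i → g K i = gIR) ∧
        EB = (fun s => R.u3.EB (bsel s) s) ∧
        (∀ (Sz : ℕ → ℝ → S.ι → ℕ → ℝ) (E₀ : ℝ) (m : ℕ) (a : ℝ) (Cw Λg : ℝ),
          (∀ K t, |t| ≤ S.l₀ → ∀ τ ∈ S.T K \ S.Bad K t, ∀ v ∈ Rd.dom, ∀ j ≤ K,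
            |∑ X ∈ L.fac K t τ with R.u3.C.scale X = j,
                (Real.log (Real.exp (EB (fun i => g (K + 1) (i + 1)) (uB K v) X
                    - EB (fun i => g (K + 1) (i + 1)) L.oneB X))
                  - Real.log (Real.exp (R.u3.EA (g K) (uA K v) X - R.u3.EA (g K) L.oneA X)))| ≤ Sz K t τ j) →
          0 ≤ E₀ → 0 < a → a < 1 →
          (∀ K t, |t| ≤ S.l₀ → ∀ τ ∈ S.T K \ S.Bad K t, ∀ j ≤ K,
            Sz K t τ j ≤ S.vol * (E₀ * ((K : ℝ) + 1) ^ m * a ^ (K - j))) →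
          (∀ K, Multiplicity (L.All K) R.u3.C.scale (fun X => Real.exp (-(R.u3.κ * R.u3.C.d X))) Cw S.vol Λg K) →
          (∀ K t, |t| ≤ S.l₀ → ∀ τ ∈ S.T K \ S.Bad K t,
            WindowMultiplicity (L.facO K t τ) L.scO L.wO Cw S.vol Λg (jlogOf L.Cl K) K) →
          1 ≤ Λg → L.θ' ≤ Λg →
          LedgerAtSync { L with S := Sz, E₀ := E₀, m := m, a := a, Cw := Cw, Λg := Λg } S.l₀ S.vol S.T S.Bad
            (fun K t τ => S.A K t τ - S.shA K t τ) (fun K t τ => S.B K t τ - S.shB K t τ) Rd R.u3.EA EB R.u3.κ g uA uB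
            R.u3.ω R.u3.ρ R.u3.θ (θ ^ ((3 : ℝ) * β - 2))) ∧
        0 ≤ S.vol ∧
        (∀ K t, |t| ≤ S.l₀ → ∀ τ ∈ S.T K \ S.Bad K t,
          WindowMultiplicity (L.facO K t τ) L.scO L.wO L.Cw S.vol L.Λg (jlogOf L.Cl K) K) ∧
        0 ≤ L.Cw ∧ 1 ≤ L.Λg ∧ L.θ' ≤ L.Λg ∧
        (∀ K, (Pf K).d = d₀) ∧ (∀ K, (Pf K).L = L₀) ∧ (∀ K, (Pf K).K = Koff + K) ∧
        (∀ K, (Fintype.card (Site (Pf K) (Pf K).K) : ℝ) = S.vol) ∧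
        kappa₀ (4 * 2 ^ d₀) (2 * d₀) ≤ R.u3.κ ∧
        (∀ K, ∀ X ∈ L.All K,
          (cells K (R.u3.C.scale X + Koff) X).Nonempty ∧ TFaceConnected (cells K (R.u3.C.scale X + Koff) X)) ∧
        (∀ K j, Set.InjOn (cells K j) ↑((L.All K).filter fun X => R.u3.C.scale X + Koff = j)) ∧
        (∀ K, ∀ X ∈ L.All K, torusTreeLen (cells K (R.u3.C.scale X + Koff) X) ≤ R.u3.C.d X) ∧
        LeafH3sup 4 R.ne3.L R.ne3.Nper R.ne3.ε R.ne3.b (c' F) R.ne3.dom ∧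
        (∀ V ∈ R.ne3.dom, ∀ k : ℕ, IsMinimiser 4 (sfClass 4 R.ne3.L R.ne3.Nper R.ne3.ε) R.ne3.L R.ne3.Nper k V (sel k V)) ∧
        (∀ V ∈ R.ne3.dom, ∀ k : ℕ, RegularSup 4 R.ne3.L R.ne3.Nper R.ne3.b (c' F) k (sel k V)) ∧
        0 < θ ∧ θ ^ 6 = ((R.ne3.L : ℝ))⁻¹ ∧
        (∀ v ∈ Rd.dom, rd v ∈ R.ne3.dom) ∧
        (∀ k, ∀ v ∈ Rd.dom, Rd.act k v = minAct 4 (sfClass 4 R.ne3.L R.ne3.Nper R.ne3.ε) R.ne3.L R.ne3.Nper k (rd v)) ∧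
        (R.ne3.Nper : ℝ) ^ 4 ≤ Rd.vol ∧
        (∀ s ∈ Window γ, 0 < bsel s ∧ bsel s ≤ γ)) :
    SpineGivenEndpointR13SepCoPHV := by
  have hρ : ∀ (F : T4Family) (θ : Stage13HParams F 2), θ.Provisos₁₃CoPH F 2 → (θ.ZhUnity F 2 ∧ θ.SlotsNondegenerate₁₃ F 2) → θ.Admissible F 2 →
      0 ≤ (ℓ F θ).ρ ∧ (ℓ F θ).ρ < 1 := fun F θ hP hG hθ => ⟨(hs F θ hP hG hθ).ρ_nonneg, (hs F θ hP hG hθ).ρ_lt_one⟩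
  have hU := fun (F : T4Family) (θ : Stage13HParams F 2) (hP : θ.Provisos₁₃CoPH F 2) (hG : (θ.ZhUnity F 2 ∧ θ.SlotsNondegenerate₁₃ F 2)) (hθ : θ.Admissible F 2) =>
    u3KernelInputs_of_finiteVolumeLetters F 2 θ.toStage13Params (ℓ F θ) (hs F θ hP hG hθ) (s F θ) (hr F θ hP hG hθ) (hinc F θ hP hG hθ) (hS F θ hP hG hθ)
      (h9 F θ hP hG hθ) (hWall 0 1 F θ hP hG hθ)
  exact fun F θ h v hG hθ _ _ =>
    hybridNE7Under_of_forSmallCouplings_stringwise (Node00.datumOfRecord₁₃SepCoPHV F 2 θ h v)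
      (show ForSmallCouplings (Node00.datumOfRecord₁₃SepCoPHV F 2 θ h v) (fun g₀ => StringwiseHybridNE7 ((Node00.datumOfRecord₁₃SepCoPHV F 2 θ h v).scheme g₀)) from
        bodyBFree₁₃CoPH_of_split (fun F (θ : Stage13HParams F 2) => (θ.ZhUnity F 2 ∧ θ.SlotsNondegenerate₁₃ F 2)) (fun F (θ : Stage13HParams F 2) => θ.ppSel = ppSelLiveOfRecord F 2 θ.ν θ.τ9 (EOfRecord₁₃ F 2 θ.toStage13Params) (wOfRecord₉ F 2 θ.toStage9Params))
          (bodyBFree₁₃CoPH_of_v5pins_coreLedgerReadingV_at_crOfRecord₁₃VAt_cut K₀ jc sh β 𝔯 ℓ s r ℓ₃ g B c'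
          (fun F (θ : Stage13HParams F 2) => (θ.ZhUnity F 2 ∧ θ.SlotsNondegenerate₁₃ F 2) ∧ θ.ppSel = ppSelLiveOfRecord F 2 θ.ν θ.τ9 (EOfRecord₁₃ F 2 θ.toStage13Params) (wOfRecord₉ F 2 θ.toStage9Params))
          ksel hpin1 hpin2 hpinL hpin (fun F hF => h16 F (hF.elim fun θ h => ⟨θ, h.1, h.2.1.1, h.2.2⟩)) (fun F θ hP hRg hθ => hs F θ hP hRg.1 hθ) (fun F θ hP hRg hθ => hκ F θ hP hRg.1 hθ)
          (fun F θ hP hRg hθ => hcr F θ hP hRg.1 hθ) (fun F θ hP hRg hθ => hκ₀ F θ hP hRg.1 hθ) (fun F θ hP hRg hθ => hr F θ hP hRg.1 hθ) (fun F θ hP hRg hθ => hinc F θ hP hRg.1 hθ)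
          (fun F θ hP hRg hθ => hS F θ hP hRg.1 hθ) (fun F θ hP hRg hθ => h9 F θ hP hRg.1 hθ) (fun μ ν F θ hP hRg hθ => hWall μ ν F θ hP hRg.1 hθ) hβ23 hβ1 hmatch hend hradii hclass
          (fun F θ hP hRg hθ => hβw F θ hP hRg.1 hθ) (fun _ _ _ hRg _ => ⟨_, hRg.2⟩) hζm h20 h21 hlinkCoreV)
          (bodyBFree₁₃CoPH_of_keyedFacesP_bFree cr' (fun F θ hP g₀ os => rateCarriersOfRecord₁₃CoPH 𝔯 F θ hP g₀ os (ksel F θ hP g₀ os))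
            (fun F (θ : Stage13HParams F 2) => (θ.ZhUnity F 2 ∧ θ.SlotsNondegenerate₁₃ F 2) ∧ ¬ θ.ppSel = ppSelLiveOfRecord F 2 θ.ν θ.τ9 (EOfRecord₁₃ F 2 θ.toStage13Params) (wOfRecord₉ F 2 θ.toStage9Params))
            (fun D R => RatesHolderAt D R β ∧ ReadOutAt D R.u3 ∧ (0 ≤ R.u3.ρ ∧ R.u3.ρ < 1)) h20' h21'
            (fun F θ hP hRg hθ => ForSmallCouplings.of_forall fun g₀ os =>
              pHolderD4Body_rateCarriers_of_kernels_pin 𝔯 θ hP g₀ os (ℓ F θ) (hpin F θ hP g₀ os) β (ksel F θ hP g₀ os)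
                (n14At_rateCarriersOfRecord₁₃CoPH_of_pinned 𝔯 hpin1 F θ hP g₀ os (ksel F θ hP g₀ os))
                (by
                  obtain ⟨b, aS, ν, μ, α, β', c35, p, hb, haS, h⟩ := hpin2
                  rw [h F θ hP g₀ os]
                  exact n15At_fullGSizedObjects_family hb haS ν μ α β' c35 p F)
                (by
                  show N16HolderAt (rateCarriersOfRecord₁₃CoPH 𝔯 F θ hP g₀ os (ksel F θ hP g₀ os)).ne3 β
                  rw [rateCarriers_ne3_of_pinnedLoose hpinL F θ hP g₀ os (ksel F θ hP g₀ os)]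
                  exact h16 F ⟨θ, hP, hRg.1, hθ⟩)
                (hs F θ hP hRg.1 hθ) (hκ F θ hP hRg.1 hθ) (hcr F θ hP hRg.1 hθ) (hρ F θ hP hRg.1 hθ) (hU F θ hP hRg.1 hθ).1 ((hU F θ hP hRg.1 hθ).2.1 _)
                ((hU F θ hP hRg.1 hθ).2.2 _))
            (keyedCoreEdgeHolderD4BFree_of_linkReadingAtCoreLedgerReading_finiteVolumeRows cr' 𝔯
              (fun {F} (θ : Stage13HParams F 2) => ((θ.ZhUnity F 2 ∧ θ.SlotsNondegenerate₁₃ F 2) ∧ ¬ θ.ppSel = ppSelLiveOfRecord F 2 θ.ν θ.τ9 (EOfRecord₁₃ F 2 θ.toStage13Params) (wOfRecord₉ F 2 θ.toStage9Params)))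
              hβ1 hlinkCore' hβ23 hpin1 ℓ hpin hpinL hmatch hend hradii hclass (fun F θ hP hRg hθ => hs F θ hP hRg.1 hθ) r (fun F θ hP hRg hθ => hr F θ hP hRg.1 hθ)
              (fun F θ hP hRg hθ => hinc F θ hP hRg.1 hθ) (fun F θ hP hRg hθ => h9 F θ hP hRg.1 hθ) (fun μ ν F θ hP hRg hθ => hWall μ ν F θ hP hRg.1 hθ) ksel (fun F θ hP hRg hθ => hβw F θ hP hRg.1 hθ))
            hx')
          F θ h.toCore hG hθ) _

end Summit.QuantumFields.YangMills.Theorems.BalabanUVNodesN27SpineRecord
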